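/-
Copyright (c) 2026 the pub-hodgecm-mathlib formalisation cell (harness21).  Prover seat hodgecm-mathlib-LH4-p14 (g6), 2026-09-04 — β-BOARD v1 rows R3∕R4∕R5 «ε-BOUNDARY LAYERS»,
arithmetic half, FILE 2: the TWO-SYSTEM twins (`A × A′`, `u′` free) of ★ p861281.
-/
import Summits.HodgeConjecture.HodgeConjecture.Theorems.F0P3cDyRamBinaryLinearFormDoubleSums   -- ★ p861281 (this seat): factorisation, class invariance, twisted single sum
import HarnessLib

/-!
# Crux `H413`, line LH4 «(D-RAM) FOUR-FRAME», STAGE-1b (β) table — THE DOUBLE CHARACTER SUMS OF A BINARY LINEAR FORM, TWO residue systems `A × A′`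

Cell `hodgecm-mathlib` (D-0151), FLOOR 0, crux item H413 = `stmt-HodgeConjecture-24833`, route `HCCMUnconditional`; squad LH4; lane `--supports stmt-HodgeConjecture-24833 --as helper`.
THEOREMS ONLY; pure local arithmetic; COUNT-NEUTRAL.

★ p861281 states the three double sums over `A × A` (one fixed-unit residue system in both variables).  LH4-p09 (g9)'s product transversal is `{1,c} × A_β × A_γ` with possibly
DIFFERENT systems (and precisions) in the two slots; this file gives the twins with the outer variable `u′` running over a second system `A′` (precision `2e′ ≥ 2d − 1`), and the
inner sum at ANY fixed unit `u′` (not necessarily a member of `A`):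
* `sum_normSign_linear_eq_of_unit` — `Σ_{u ∈ A} ω(C₀u′ + C₁ϖ_F^j u) = ω(u′)·Σ_{a ∈ A} ω(C₀ + C₁ϖ_F^j a)` for every fixed unit `u′`;
* `sum_normSign_fst_mul_linear_eq_of_unit` — `Σ_{u ∈ A} ω(u)·ω(C₀u′ + C₁ϖ_F^j u) = 0` for every fixed unit `u′` (`|2| < 1`);
* (iii′) `sum_sum_normSign_linear_eq_zero₂`, (i′) `sum_sum_normSign_snd_mul_linear_eq₂` (`= #A′ · Σ_{a ∈ A} ω(C₀ + C₁ϖ_F^j a)`), (ii′) `sum_sum_normSign_fst_mul_linear_eq_zero₂` over `A × A′`.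
HONEST LABEL.  Count-neutral; table∕(β-BAL)∕(β)∕T₊ stay OPEN; HC_CM is proved only modulo the 7 printed citations (2 remaining named inputs: hLiu418 = `stmt-HodgeConjecture-24832`,
h413 = `stmt-HodgeConjecture-24833`) until rung 0 closes.

## References
* [Serre1979] J.-P. Serre, *Local Fields*, GTM 67 (1979) — Ch. V §3 Prop. 5, Cor. 2–3, Ch. XV §2.
* [NeukirchANT1999] J. Neukirch, *Algebraic Number Theory* (1999) — Ch. V (1.3).
-/

set_option autoImplicit false

noncomputable section

namespace Summit.HodgeConjecture.HodgeConjecture.Cruxes.H413.F0P3cDyRamBinaryLinearFormDoubleSumsTwo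

open WithZero
open scoped Valued
open Literature.NumberTheory.Automorphic.UnitaryThreeFourFrame
open Literature.NumberTheory.LocalFields.WildQuadraticDatum
open Summit.HodgeConjecture.HodgeConjecture.Cruxes.H413.F0P3cDyRamBinaryLinearFormDoubleSums

variable {K : Type} [Field K] [Valued K ℤᵐ⁰] {σ : K →+* K} {ϖ : K} {d t : ℕ}

/-! ## §1  The inner sums at an arbitrary fixed unit `u′` -/

/-- **THE INNER SUM AT ANY FIXED UNIT `u′`**: `Σ_{u ∈ A} ω(C₀u′ + C₁ϖ_F^j u) = ω(u′)·Σ_{a ∈ A} ω(C₀ + C₁ϖ_F^j a)` (`A` a fixed-unit residue system mod `|ϖ|^{2e}`, `2d − 1 ≤ 2e`,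
`j ≥ 1`; `u′` fixed with `|u′| = 1`). [cite: Serre1979, Ch. V §3 Cor. 3; Ch. XV §2] -/
theorem sum_normSign_linear_eq_of_unit [CompleteSpace K] [Finite 𝓀[K]] (hD : IsRamifiedQuadraticDatum σ ϖ d t)
    {C₀ C₁ : K} (hσC₀ : σ C₀ = C₀) (hC₀ : Valued.v C₀ = 1) (hσC₁ : σ C₁ = C₁) (hC₁ : Valued.v C₁ ≤ 1) {j e : ℕ} (hj : 1 ≤ j) (he : 2 * d - 1 ≤ 2 * e)
    (A : Finset K) (hA₁ : ∀ a ∈ A, σ a = a ∧ Valued.v a = 1)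
    (hA₂ : ∀ u : K, σ u = u → Valued.v u = 1 → ∃ a ∈ A, Valued.v (u - a) ≤ Valued.v ϖ ^ (2 * e))
    (hA₃ : ∀ a ∈ A, ∀ a' ∈ A, Valued.v (a - a') ≤ Valued.v ϖ ^ (2 * e) → a = a') {u' : K} (hσu' : σ u' = u') (hu'1 : Valued.v u' = 1) :
    ∑ u ∈ A, normSign σ (C₀ * u' + C₁ * (ϖ * σ ϖ) ^ j * u) = normSign σ u' * ∑ a ∈ A, normSign σ (C₀ + C₁ * (ϖ * σ ϖ) ^ j * a) := by
  classical
  obtain ⟨hσ, hvσ, hϖ, -, -, hd1, -⟩ := id hD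
  have hu'0 : u' ≠ 0 := fun h => by rw [h, map_zero] at hu'1; exact zero_ne_one hu'1
  have hsmall : Valued.v ϖ ^ (2 * e) < 1 := by
    rw [hϖ, ← exp_nsmul, nsmul_eq_mul, mul_neg, mul_one, ← exp_zero]; exact exp_lt_exp.2 (by omega)
  -- the quotient map and its representative
  have hq : ∀ u ∈ A, σ (u / u') = u / u' ∧ Valued.v (u / u') = 1 := fun u hu => by
    obtain ⟨hσu, hu1⟩ := hA₁ u hu
    exact ⟨by rw [map_div₀, hσu, hσu'], by rw [map_div₀, hu1, hu'1, div_one]⟩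
  have hrep : ∀ u ∈ A, ∃ a ∈ A, Valued.v (u / u' - a) ≤ Valued.v ϖ ^ (2 * e) := fun u hu => hA₂ _ (hq u hu).1 (hq u hu).2
  choose! Φ hΦA hΦ using hrep
  -- termwise: `ω(C₀u′ + C₁ϖ_F^j u) = ω(u′)·ω(C₀ + C₁ϖ_F^j Φ u)`
  have hterm : ∀ u ∈ A, normSign σ (C₀ * u' + C₁ * (ϖ * σ ϖ) ^ j * u) = normSign σ u' * normSign σ (C₀ + C₁ * (ϖ * σ ϖ) ^ j * Φ u) := by
    intro u hu
    have hv1 := v_affine_eq_one hD hC₀ hC₁ (hq u hu).2.le hj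
    rw [normSign_linear_eq_mul hD hσC₀ hσC₁ (hA₁ u hu).1 hσu' hu'0 j (fun h => by rw [h, map_zero] at hv1; exact zero_ne_one hv1),
      normSign_affine_eq_of_near hD hσC₀ hC₀ hσC₁ hC₁ (hq u hu).1 (hq u hu).2.le (hA₁ _ (hΦA u hu)).1 hj he (hΦ u hu)]
  rw [Finset.sum_congr rfl hterm, ← Finset.mul_sum]
  congr 1
  -- `Φ` is a bijection of `A`
  have hinj : ∀ u₁ ∈ A, ∀ u₂ ∈ A, Φ u₁ = Φ u₂ → u₁ = u₂ := by
    intro u₁ hu₁ u₂ hu₂ heq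
    refine hA₃ u₁ hu₁ u₂ hu₂ ?_
    have h1 : Valued.v (u₁ / u' - u₂ / u') ≤ Valued.v ϖ ^ (2 * e) := by
      rw [show u₁ / u' - u₂ / u' = (u₁ / u' - Φ u₁) - (u₂ / u' - Φ u₂) by rw [heq]; ring]
      exact (Valuation.map_sub _ _ _).trans (max_le (hΦ u₁ hu₁) (hΦ u₂ hu₂))
    rwa [← sub_div, map_div₀, hu'1, div_one] at h1
  exact Finset.sum_bij (fun u _ => Φ u) (fun u hu => hΦA u hu) (fun u₁ hu₁ u₂ hu₂ h => hinj u₁ hu₁ u₂ hu₂ h)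
    (fun a ha => by
      have himg : A.image Φ = A := Finset.eq_of_subset_of_card_le (Finset.image_subset_iff.2 fun u hu => hΦA u hu)
        (by rw [Finset.card_image_of_injOn (fun u₁ hu₁ u₂ hu₂ h => hinj u₁ hu₁ u₂ hu₂ h)])
      have ha' : a ∈ A.image Φ := by rw [himg]; exact ha
      obtain ⟨u, hu, hua⟩ := Finset.mem_image.1 ha'
      exact ⟨u, hu, hua⟩)
    (fun _ _ => rfl)


/-- **THE TWISTED INNER SUM AT ANY FIXED UNIT `u′` VANISHES**: `Σ_{u ∈ A} ω(u)·ω(C₀u′ + C₁ϖ_F^j u) = 0` (`|2| < 1`; `ω(u) = ω(u′)ω(u∕u′)`, re-index by `u ↦ rep(u∕u′)`, then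
★ `sum_normSign_mul_affine_eq_zero`). [cite: Serre1979, Ch. V §3 Cor. 3; Ch. XV §2] -/
theorem sum_normSign_fst_mul_linear_eq_of_unit [CompleteSpace K] [Finite 𝓀[K]] (hD : IsRamifiedQuadraticDatum σ ϖ d t) (h2v : Valued.v (2 : K) < 1)
    {C₀ C₁ : K} (hσC₀ : σ C₀ = C₀) (hC₀ : Valued.v C₀ = 1) (hσC₁ : σ C₁ = C₁) (hC₁ : Valued.v C₁ ≤ 1) {j e : ℕ} (hj : 1 ≤ j) (he : 2 * d - 1 ≤ 2 * e)
    (A : Finset K) (hA₁ : ∀ a ∈ A, σ a = a ∧ Valued.v a = 1)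
    (hA₂ : ∀ u : K, σ u = u → Valued.v u = 1 → ∃ a ∈ A, Valued.v (u - a) ≤ Valued.v ϖ ^ (2 * e))
    (hA₃ : ∀ a ∈ A, ∀ a' ∈ A, Valued.v (a - a') ≤ Valued.v ϖ ^ (2 * e) → a = a') {u' : K} (hσu' : σ u' = u') (hu'1 : Valued.v u' = 1) :
    ∑ u ∈ A, normSign σ u * normSign σ (C₀ * u' + C₁ * (ϖ * σ ϖ) ^ j * u) = 0 := by
  classical
  obtain ⟨hσ, hvσ, hϖ, -, -, hd1, -⟩ := id hD
  have hu'0 : u' ≠ 0 := fun h => by rw [h, map_zero] at hu'1; exact zero_ne_one hu'1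
  have hq : ∀ u ∈ A, σ (u / u') = u / u' ∧ Valued.v (u / u') = 1 := fun u hu => by
    obtain ⟨hσu, hu1⟩ := hA₁ u hu
    exact ⟨by rw [map_div₀, hσu, hσu'], by rw [map_div₀, hu1, hu'1, div_one]⟩
  have hrep : ∀ u ∈ A, ∃ a ∈ A, Valued.v (u / u' - a) ≤ Valued.v ϖ ^ (2 * e) := fun u hu => hA₂ _ (hq u hu).1 (hq u hu).2
  choose! Φ hΦA hΦ using hrep
  -- termwise: `ω(u)·ω(C₀u′ + C₁ϖ_F^j u) = ω(Φ u)·ω(C₀ + C₁ϖ_F^j Φ u)` (`ω(u′)² = 1`)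
  have hterm : ∀ u ∈ A, normSign σ u * normSign σ (C₀ * u' + C₁ * (ϖ * σ ϖ) ^ j * u) =
      normSign σ (Φ u) * normSign σ (C₀ + C₁ * (ϖ * σ ϖ) ^ j * Φ u) := by
    intro u hu
    obtain ⟨hσu, hu1⟩ := hA₁ u hu
    have hu0 : u ≠ 0 := fun h => by rw [h, map_zero] at hu1; exact zero_ne_one hu1
    have hv1 := v_affine_eq_one hD hC₀ hC₁ (hq u hu).2.le hj
    have hωu : normSign σ u = normSign σ u' * normSign σ (Φ u) := by
      rw [normSign_eq_of_near hD (hq u hu).1 (hA₁ _ (hΦA u hu)).1 (hq u hu).2 he (hΦ u hu), ← normSign_mul_of_fixed hD hσu' (hq u hu).1 hu'0 (div_ne_zero hu0 hu'0),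
        mul_div_cancel₀ _ hu'0]
    rw [hωu, normSign_linear_eq_mul hD hσC₀ hσC₁ hσu hσu' hu'0 j (fun h => by rw [h, map_zero] at hv1; exact zero_ne_one hv1),
      ← normSign_affine_eq_of_near hD hσC₀ hC₀ hσC₁ hC₁ (hq u hu).1 (hq u hu).2.le (hA₁ _ (hΦA u hu)).1 hj he (hΦ u hu)]
    have hsq : normSign σ u' * normSign σ u' = 1 := by
      unfold normSign; split_ifs <;> norm_num
    calc normSign σ u' * normSign σ (Φ u) * (normSign σ u' * normSign σ (C₀ + C₁ * (ϖ * σ ϖ) ^ j * Φ u))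
        = (normSign σ u' * normSign σ u') * (normSign σ (Φ u) * normSign σ (C₀ + C₁ * (ϖ * σ ϖ) ^ j * Φ u)) := by ring
      _ = _ := by rw [hsq, one_mul]
  rw [Finset.sum_congr rfl hterm]
  -- re-index by the bijection `Φ` and apply the twisted single sum
  have hinj : ∀ u₁ ∈ A, ∀ u₂ ∈ A, Φ u₁ = Φ u₂ → u₁ = u₂ := by
    intro u₁ hu₁ u₂ hu₂ heq
    refine hA₃ u₁ hu₁ u₂ hu₂ ?_
    have h1 : Valued.v (u₁ / u' - u₂ / u') ≤ Valued.v ϖ ^ (2 * e) := by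
      rw [show u₁ / u' - u₂ / u' = (u₁ / u' - Φ u₁) - (u₂ / u' - Φ u₂) by rw [heq]; ring]
      exact (Valuation.map_sub _ _ _).trans (max_le (hΦ u₁ hu₁) (hΦ u₂ hu₂))
    rwa [← sub_div, map_div₀, hu'1, div_one] at h1
  rw [Finset.sum_bij (s := A) (t := A) (g := fun a => normSign σ a * normSign σ (C₀ + C₁ * (ϖ * σ ϖ) ^ j * a)) (fun u _ => Φ u) (fun u hu => hΦA u hu)
    (fun u₁ hu₁ u₂ hu₂ h => hinj u₁ hu₁ u₂ hu₂ h)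
    (fun a ha => by
      have himg : A.image Φ = A := Finset.eq_of_subset_of_card_le (Finset.image_subset_iff.2 fun u hu => hΦA u hu)
        (by rw [Finset.card_image_of_injOn (fun u₁ hu₁ u₂ hu₂ h => hinj u₁ hu₁ u₂ hu₂ h)])
      have ha' : a ∈ A.image Φ := by rw [himg]; exact ha
      obtain ⟨u, hu, hua⟩ := Finset.mem_image.1 ha'
      exact ⟨u, hu, hua⟩)
    (fun _ _ => rfl)]
  exact sum_normSign_mul_affine_eq_zero hD h2v hσC₀ hC₀ hσC₁ hC₁ hj he A hA₁ hA₂ hA₃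


/-! ## §2  The three double sums over `A × A′` -/

/-- **(iii′)** `Σ_{u ∈ A} Σ_{u′ ∈ A′} ω(C₀u′ + C₁ϖ_F^j u) = 0` (`A′` a second fixed-unit residue system, precision `2e′ ≥ 2d − 1`). [cite: Serre1979, Ch. V §3 Cor. 3; Ch. XV §2] -/
theorem sum_sum_normSign_linear_eq_zero₂ [CompleteSpace K] [Finite 𝓀[K]] (hD : IsRamifiedQuadraticDatum σ ϖ d t) (h2v : Valued.v (2 : K) < 1)
    {C₀ C₁ : K} (hσC₀ : σ C₀ = C₀) (hC₀ : Valued.v C₀ = 1) (hσC₁ : σ C₁ = C₁) (hC₁ : Valued.v C₁ ≤ 1) {j e e' : ℕ} (hj : 1 ≤ j) (he : 2 * d - 1 ≤ 2 * e)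
    (he' : 2 * d - 1 ≤ 2 * e')
    (A : Finset K) (hA₁ : ∀ a ∈ A, σ a = a ∧ Valued.v a = 1)
    (hA₂ : ∀ u : K, σ u = u → Valued.v u = 1 → ∃ a ∈ A, Valued.v (u - a) ≤ Valued.v ϖ ^ (2 * e))
    (hA₃ : ∀ a ∈ A, ∀ a' ∈ A, Valued.v (a - a') ≤ Valued.v ϖ ^ (2 * e) → a = a')
    (A' : Finset K) (hA'₁ : ∀ a ∈ A', σ a = a ∧ Valued.v a = 1)
    (hA'₂ : ∀ u : K, σ u = u → Valued.v u = 1 → ∃ a ∈ A', Valued.v (u - a) ≤ Valued.v ϖ ^ (2 * e'))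
    (hA'₃ : ∀ a ∈ A', ∀ a' ∈ A', Valued.v (a - a') ≤ Valued.v ϖ ^ (2 * e') → a = a') :
    ∑ u ∈ A, ∑ u' ∈ A', normSign σ (C₀ * u' + C₁ * (ϖ * σ ϖ) ^ j * u) = 0 := by
  classical
  rw [Finset.sum_comm]
  have hin : ∀ u' ∈ A', ∑ u ∈ A, normSign σ (C₀ * u' + C₁ * (ϖ * σ ϖ) ^ j * u) = normSign σ u' * ∑ a ∈ A, normSign σ (C₀ + C₁ * (ϖ * σ ϖ) ^ j * a) :=
    fun u' hu' => sum_normSign_linear_eq_of_unit hD hσC₀ hC₀ hσC₁ hC₁ hj he A hA₁ hA₂ hA₃ (hA'₁ u' hu').1 (hA'₁ u' hu').2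
  rw [Finset.sum_congr rfl hin, ← Finset.sum_mul]
  have hF1 : ∑ u' ∈ A', normSign σ u' = 0 :=
    sum_normSign_repr_eq_zero hD h2v (A := {f : K | σ f = f ∧ Valued.v f = 1}) he' (fun f hf => hf)
      (fun f hf a hσa ha1 _ => ⟨by rw [map_mul, hσa, hf.1], by rw [map_mul, ha1, hf.2, one_mul]⟩) A' (fun g hg => hA'₁ g hg)
      (fun f hf => hA'₂ f hf.1 hf.2) hA'₃
  rw [hF1, zero_mul]

/-- **(i′)** `Σ_{u ∈ A} Σ_{u′ ∈ A′} ω(u′)·ω(C₀u′ + C₁ϖ_F^j u) = #A′ · Σ_{a ∈ A} ω(C₀ + C₁ϖ_F^j a)`. [cite: Serre1979, Ch. V §3 Cor. 3; Ch. XV §2] -/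
theorem sum_sum_normSign_snd_mul_linear_eq₂ [CompleteSpace K] [Finite 𝓀[K]] (hD : IsRamifiedQuadraticDatum σ ϖ d t)
    {C₀ C₁ : K} (hσC₀ : σ C₀ = C₀) (hC₀ : Valued.v C₀ = 1) (hσC₁ : σ C₁ = C₁) (hC₁ : Valued.v C₁ ≤ 1) {j e : ℕ} (hj : 1 ≤ j) (he : 2 * d - 1 ≤ 2 * e)
    (A : Finset K) (hA₁ : ∀ a ∈ A, σ a = a ∧ Valued.v a = 1)
    (hA₂ : ∀ u : K, σ u = u → Valued.v u = 1 → ∃ a ∈ A, Valued.v (u - a) ≤ Valued.v ϖ ^ (2 * e))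
    (hA₃ : ∀ a ∈ A, ∀ a' ∈ A, Valued.v (a - a') ≤ Valued.v ϖ ^ (2 * e) → a = a')
    (A' : Finset K) (hA'₁ : ∀ a ∈ A', σ a = a ∧ Valued.v a = 1) :
    ∑ u ∈ A, ∑ u' ∈ A', normSign σ u' * normSign σ (C₀ * u' + C₁ * (ϖ * σ ϖ) ^ j * u) = (A'.card : ℤ) * ∑ a ∈ A, normSign σ (C₀ + C₁ * (ϖ * σ ϖ) ^ j * a) := by
  classical
  rw [Finset.sum_comm]
  have hin : ∀ u' ∈ A', ∑ u ∈ A, normSign σ u' * normSign σ (C₀ * u' + C₁ * (ϖ * σ ϖ) ^ j * u) = ∑ a ∈ A, normSign σ (C₀ + C₁ * (ϖ * σ ϖ) ^ j * a) := by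
    intro u' hu'
    have hsq : normSign σ u' * normSign σ u' = 1 := by
      unfold normSign; split_ifs <;> norm_num
    rw [← Finset.mul_sum, sum_normSign_linear_eq_of_unit hD hσC₀ hC₀ hσC₁ hC₁ hj he A hA₁ hA₂ hA₃ (hA'₁ u' hu').1 (hA'₁ u' hu').2, ← mul_assoc, hsq, one_mul]
  rw [Finset.sum_congr rfl hin, Finset.sum_const, nsmul_eq_mul]

/-- **(ii′)** `Σ_{u ∈ A} Σ_{u′ ∈ A′} ω(u)·ω(C₀u′ + C₁ϖ_F^j u) = 0` (`|2| < 1`). [cite: Serre1979, Ch. V §3 Cor. 3; Ch. XV §2] -/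
theorem sum_sum_normSign_fst_mul_linear_eq_zero₂ [CompleteSpace K] [Finite 𝓀[K]] (hD : IsRamifiedQuadraticDatum σ ϖ d t) (h2v : Valued.v (2 : K) < 1)
    {C₀ C₁ : K} (hσC₀ : σ C₀ = C₀) (hC₀ : Valued.v C₀ = 1) (hσC₁ : σ C₁ = C₁) (hC₁ : Valued.v C₁ ≤ 1) {j e : ℕ} (hj : 1 ≤ j) (he : 2 * d - 1 ≤ 2 * e)
    (A : Finset K) (hA₁ : ∀ a ∈ A, σ a = a ∧ Valued.v a = 1)
    (hA₂ : ∀ u : K, σ u = u → Valued.v u = 1 → ∃ a ∈ A, Valued.v (u - a) ≤ Valued.v ϖ ^ (2 * e))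
    (hA₃ : ∀ a ∈ A, ∀ a' ∈ A, Valued.v (a - a') ≤ Valued.v ϖ ^ (2 * e) → a = a')
    (A' : Finset K) (hA'₁ : ∀ a ∈ A', σ a = a ∧ Valued.v a = 1) :
    ∑ u ∈ A, ∑ u' ∈ A', normSign σ u * normSign σ (C₀ * u' + C₁ * (ϖ * σ ϖ) ^ j * u) = 0 := by
  classical
  rw [Finset.sum_comm]
  exact Finset.sum_eq_zero fun u' hu' => sum_normSign_fst_mul_linear_eq_of_unit hD h2v hσC₀ hC₀ hσC₁ hC₁ hj he A hA₁ hA₂ hA₃ (hA'₁ u' hu').1 (hA'₁ u' hu').2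

end Summit.HodgeConjecture.HodgeConjecture.Cruxes.H413.F0P3cDyRamBinaryLinearFormDoubleSumsTwo

end
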